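import Literature.NumberTheory.EllipticCurves.SzpiroNumberFieldMinimalityProofs
import HarnessLib

/-!
# `abc ⟹ Szpiro` over a number field, II: the local inequality at each finite place

Companion PROOF file (theorems only) of `Literature.NumberTheory.EllipticCurves.Szpiro`: the
prime-by-prime content of Silverman AEC Prop. VIII.11.5(b) / Exercise 8.21 («abc implies Szpiro»)
for an elliptic curve `W` over a number field `K` at a finite place `v`, read off the local minimal
model (no global minimal model is used). With `x = c₄³/(1728 Δ) = j/1728`, `L = log N(v)`,
`d = ord_v 𝔇_min` (`ordMinimalDiscriminant`), `f = f_v` (`conductorExponent`, Ogg's formula),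
`δ = [v ∈ badPrimes x (1−x) 1]` and `c_v = 0` if `v ∤ 6`, `c_v = 3 ord_v 1728 + 5` otherwise:

* `WeierstrassCurve.szpiro_local_ineq`:
  `d L + 6 δ L ≤ 6 f L + log⁺‖x‖_v + 2 log⁺‖x⁻¹‖_v + 3 log⁺‖(1−x)⁻¹‖_v + 6 c_v L` and
  `6 δ L ≤ 6 f L + 2 log⁺‖x⁻¹‖_v + 3 log⁺‖(1−x)⁻¹‖_v + 6 c_v L` (case `c₄ c₆ ≠ 0`);
* the degenerate case `c₄ = 0` or `c₆ = 0` (`d L ≤ 6 f L + 6 c_v L`) is in the sibling file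
  `SzpiroNumberFieldLocalDegenerateProofs`.

Summed over `v` these give `log N(𝔇_min) ≤ 6 log N(𝔣) + 6·(finite height sums of x) − 6·(radical of
x) + O_K(1)`, which the uniform abc conjecture / Vojta's inequality for `ℙ¹ ∖ {0,1,∞}` turns into
Szpiro's conjecture over `K` (assembled in `SzpiroNumberFieldOfVojtaProofs`). Ingredients: the
reduction-type trichotomy and its reading on the local minimal integral model
(`hasMultiplicativeReductionAt_iff_mem`, `hasAdditiveReductionAt_iff_mem`), `f_v = 0 / ≥ 1 / ≥ 2`
(`ordMinimalDiscriminant_eq_zero_iff_holds`, `conductorExponent_ne_zero_iff_ordMinimalDiscriminant_ne_zero`,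
`two_le_conductorExponent_iff_holds`; the residue field of `O_v` is finite, hence perfect), and the
minimality constraint `localMinimal_ord_c₄_c₆_lt` of part I.

## References

* J. H. Silverman, *The Arithmetic of Elliptic Curves*, GTM 106, 2nd ed. 2009, VII.1, VII.5.1,
  VIII.11 Prop. 11.5(b) and Ex. 8.21. [SilvermanAEC2009]
-/

open IsDedekindDomain NumberField

namespace WeierstrassCurve

open Literature.NumberTheory.EllipticCurves.SzpiroLocal

section Helpers

variable {K : Type*} [Field K] [NumberField K] (v : HeightOneSpectrum (𝓞 K))

/-- The normalised absolute value at `v` of `y` with `v(y) = exp k` is `N(v) ^ k`. [folklore] -/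
private theorem finitePlace_mk_eq_zpow {y : K} {k : ℤ} (hy : v.valuation K y = WithZero.exp k) :
    (FinitePlace.mk v y : ℝ) = (Ideal.absNorm v.asIdeal : ℝ) ^ k := by
  rw [FinitePlace.mk_apply, FinitePlace.norm_embedding', hy,
    WithZeroMulInt.toNNReal_neg_apply _ WithZero.exp_ne_zero]
  push_cast
  rfl

/-- `log max(1, ‖y‖_v) = max(0, k) · log N(v)` when `v(y) = exp k`. [folklore] -/
private theorem log_max_one_finitePlace {y : K} {k : ℤ} (hy : v.valuation K y = WithZero.exp k) :
    Real.log (max 1 (FinitePlace.mk v y)) = (max 0 k : ℤ) * Real.log (Ideal.absNorm v.asIdeal) := by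
  rw [finitePlace_mk_eq_zpow v hy]
  have hN : (1 : ℝ) < (Ideal.absNorm v.asIdeal : ℝ) := by
    exact_mod_cast NumberField.HeightOneSpectrum.one_lt_absNorm v
  have hmax : max (1 : ℝ) ((Ideal.absNorm v.asIdeal : ℝ) ^ k) =
      (Ideal.absNorm v.asIdeal : ℝ) ^ (max 0 k : ℤ) := by
    rcases le_or_gt 0 k with hk | hk
    · rw [max_eq_right hk, max_eq_right (one_le_zpow₀ hN.le hk)]
    · rw [max_eq_left hk.le, zpow_zero, max_eq_left]
      exact (zpow_lt_one_of_neg₀ hN hk).le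
  rw [hmax, Real.log_zpow]

/-- `exp p / exp q = exp (p - q)` in `ℤᵐ⁰`. [folklore] -/
private theorem withZero_exp_div (p q : ℤ) : WithZero.exp p / WithZero.exp q = WithZero.exp (p - q) := by
  rw [div_eq_iff WithZero.exp_ne_zero, ← WithZero.exp_add, sub_add_cancel]

/-- `(exp k)^n = exp (n k)` in `ℤᵐ⁰`. [folklore] -/
private theorem withZero_exp_pow (k : ℤ) (n : ℕ) :
    WithZero.exp k ^ n = WithZero.exp ((n : ℤ) * k) := by
  rw [← WithZero.exp_nsmul, nsmul_eq_mul]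

/-- The residue field of `O_v` is perfect (it is finite). [folklore] -/
private theorem perfectField_residueField_adicCompletionIntegers' : PerfectField
    (IsLocalRing.ResidueField (v.adicCompletionIntegers K)) := by
  haveI := v.isMaximal
  exact PerfectField.ofFinite

end Helpers

section LocalIneq

variable {K : Type*} [Field K] [NumberField K] (v : HeightOneSpectrum (𝓞 K))
  (W : WeierstrassCurve K) [W.IsElliptic]

open Classical in
/-- **Local Szpiro inequality at a finite place** (the prime-by-prime content of «abc ⟹ Szpiro»,
Silverman AEC VIII.11.5(b) / Ex. 8.21, for a number field): with `x = c₄³/(1728 Δ) = j/1728`,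
`L = log N(v)`, `d = ord_v(𝔇_min)`, `f = f_v`, `δ = [v bad for (x : 1−x : 1)]`, `t₂ = ord_v 2`,
`t₃ = ord_v 3`:  `d·L + 6δ·L ≤ 6f·L + log⁺‖x‖_v + 2 log⁺‖x⁻¹‖_v + 3 log⁺‖(1−x)⁻¹‖_v + 6c·L` and
`6δ·L ≤ 6f·L + 2 log⁺‖x⁻¹‖_v + 3 log⁺‖(1−x)⁻¹‖_v + 6c·L`, where `c = 0` unless `v ∣ 6`
(`c = 3·ord_v(1728) + 5` then). [cite: SilvermanAEC2009, Prop. VIII.11.5(b) and Ex. 8.21] -/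
theorem szpiro_local_ineq (hc4 : W.c₄ ≠ 0) (hc6 : W.c₆ ≠ 0) (x : K)
    (hx : x = W.c₄ ^ 3 / (1728 * W.Δ)) (t₂ t₃ : ℕ)
    (ht₂ : v.valuation K (2 : K) = WithZero.exp (-(t₂ : ℤ)))
    (ht₃ : v.valuation K (3 : K) = WithZero.exp (-(t₃ : ℤ))) :
    ((W.ordMinimalDiscriminant v : ℝ) * Real.log (Ideal.absNorm v.asIdeal) +
        6 * (if v ∈ Literature.NumberTheory.DiophantineGeometry.badPrimes x (1 - x) 1 then
          Real.log (Ideal.absNorm v.asIdeal) else 0)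
      ≤ 6 * (W.conductorExponent v : ℝ) * Real.log (Ideal.absNorm v.asIdeal)
        + Real.log (max 1 (FinitePlace.mk v x))
        + 2 * Real.log (max 1 (FinitePlace.mk v x⁻¹))
        + 3 * Real.log (max 1 (FinitePlace.mk v (1 - x)⁻¹))
        + 6 * (if t₂ + t₃ = 0 then (0 : ℝ) else 3 * (6 * t₂ + 3 * t₃) + 5) *
          Real.log (Ideal.absNorm v.asIdeal)) ∧
    (6 * (if v ∈ Literature.NumberTheory.DiophantineGeometry.badPrimes x (1 - x) 1 then
          Real.log (Ideal.absNorm v.asIdeal) else 0)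
      ≤ 6 * (W.conductorExponent v : ℝ) * Real.log (Ideal.absNorm v.asIdeal)
        + 2 * Real.log (max 1 (FinitePlace.mk v x⁻¹))
        + 3 * Real.log (max 1 (FinitePlace.mk v (1 - x)⁻¹))
        + 6 * (if t₂ + t₃ = 0 then (0 : ℝ) else 3 * (6 * t₂ + 3 * t₃) + 5) *
          Real.log (Ideal.absNorm v.asIdeal)) := by
  classical
  haveI := perfectField_residueField_adicCompletionIntegers' v
  set M := W.localMinimalIntegralModel v with hM
  have hMΔ : M.Δ ≠ 0 := localMinimalIntegralModel_Δ_ne_zero v W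
  have hΔK : W.Δ ≠ 0 := W.isUnit_Δ.ne_zero
  have h1728K : (1728 : K) ≠ 0 := by norm_num
  have hx0 : x ≠ 0 := by
    rw [hx]; exact div_ne_zero (pow_ne_zero 3 hc4) (mul_ne_zero h1728K hΔK)
  have hc₄_cube := algebraMap_c₄_cube_div v W
  have hc₆_sq := algebraMap_c₆_sq_div v W
  have hMc4 : M.c₄ ≠ 0 := by
    intro h0
    have h1 : algebraMap K (v.adicCompletion K) (W.c₄ ^ 3 / (1728 * W.Δ)) = 0 := by
      rw [hc₄_cube, ← hM, h0]; simp
    rw [map_eq_zero] at h1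
    exact hx0 (hx ▸ h1)
  have hy0 : W.c₆ ^ 2 / (1728 * W.Δ) ≠ 0 :=
    div_ne_zero (pow_ne_zero 2 hc6) (mul_ne_zero h1728K hΔK)
  have hMc6 : M.c₆ ≠ 0 := by
    intro h0
    have h1 : algebraMap K (v.adicCompletion K) (W.c₆ ^ 2 / (1728 * W.Δ)) = 0 := by
      rw [hc₆_sq, ← hM, h0]; simp
    rw [map_eq_zero] at h1
    exact hy0 h1
  -- exponents
  obtain ⟨a, haM, ha⟩ :=
    IsDedekindDomain.HeightOneSpectrum.exists_addVal_adicCompletionIntegers_eq K v M.c₄ hMc4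
  obtain ⟨b, hbM, hb⟩ :=
    IsDedekindDomain.HeightOneSpectrum.exists_addVal_adicCompletionIntegers_eq K v M.c₆ hMc6
  obtain ⟨d, hdM, hd⟩ :=
    IsDedekindDomain.HeightOneSpectrum.exists_addVal_adicCompletionIntegers_eq K v M.Δ hMΔ
  have hdord : W.ordMinimalDiscriminant v = d := by
    change (IsDiscreteValuationRing.addVal (v.adicCompletionIntegers K) M.Δ).toNat = d
    rw [hdM]; rfl
  -- valuations of `2`, `3`, `1728` in `K_v`
  have h2v : Valued.v (2 : v.adicCompletion K) = WithZero.exp (-(t₂ : ℤ)) := by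
    have h := valued_algebraMap_adicCompletion v (2 : K)
    rwa [map_ofNat, ht₂] at h
  have h3v : Valued.v (3 : v.adicCompletion K) = WithZero.exp (-(t₃ : ℤ)) := by
    have h := valued_algebraMap_adicCompletion v (3 : K)
    rwa [map_ofNat, ht₃] at h
  have h1728 : Valued.v (1728 : v.adicCompletion K) =
      WithZero.exp (-((6 * t₂ + 3 * t₃ : ℕ) : ℤ)) := by
    rw [show (1728 : v.adicCompletion K) = 2 ^ 6 * 3 ^ 3 by norm_num, map_mul, map_pow, map_pow,
      h2v, h3v, withZero_exp_pow, withZero_exp_pow, ← WithZero.exp_add]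
    congr 1; push_cast; ring
  -- valuation of `x` and of `c₆² / (1728 Δ)`
  have hvx : v.valuation K x = WithZero.exp (((6 * t₂ + 3 * t₃ : ℕ) : ℤ) + d - 3 * a) := by
    rw [← valued_algebraMap_adicCompletion, hx, hc₄_cube, ← hM, map_div₀, map_pow, map_mul,
      h1728, ha, hd, withZero_exp_pow, ← WithZero.exp_add, withZero_exp_div]
    congr 1; ring
  have hvy : v.valuation K (W.c₆ ^ 2 / (1728 * W.Δ)) =
      WithZero.exp (((6 * t₂ + 3 * t₃ : ℕ) : ℤ) + d - 2 * b) := by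
    rw [← valued_algebraMap_adicCompletion, hc₆_sq, ← hM, map_div₀, map_pow, map_mul,
      h1728, hb, hd, withZero_exp_pow, ← WithZero.exp_add, withZero_exp_div]
    congr 1; ring
  have h1x : 1 - x = -(W.c₆ ^ 2 / (1728 * W.Δ)) := by
    rw [hx, one_sub_div (mul_ne_zero h1728K hΔK),
      show 1728 * W.Δ - W.c₄ ^ 3 = -(W.c₆ ^ 2) by linear_combination W.c_relation, neg_div]
  have hv1x : v.valuation K (1 - x) = WithZero.exp (((6 * t₂ + 3 * t₃ : ℕ) : ℤ) + d - 2 * b) := by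
    rw [h1x, Valuation.map_neg, hvy]
  have hvxi : v.valuation K x⁻¹ = WithZero.exp (3 * a - (((6 * t₂ + 3 * t₃ : ℕ) : ℤ) + d)) := by
    rw [map_inv₀, hvx, ← WithZero.exp_neg]; congr 1; ring
  have hv1xi : v.valuation K (1 - x)⁻¹ =
      WithZero.exp (2 * b - (((6 * t₂ + 3 * t₃ : ℕ) : ℤ) + d)) := by
    rw [map_inv₀, hv1x, ← WithZero.exp_neg]; congr 1; ring
  -- bad support
  have hbad : v ∈ Literature.NumberTheory.DiophantineGeometry.badPrimes x (1 - x) 1 ↔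
      (3 * (a : ℤ) - (6 * t₂ + 3 * t₃ + d) ≠ 0 ∨ 2 * (b : ℤ) - (6 * t₂ + 3 * t₃ + d) ≠ 0) := by
    simp only [Literature.NumberTheory.DiophantineGeometry.badPrimes, Set.mem_setOf_eq, hvx, hv1x,
      map_one, ← WithZero.exp_zero, WithZero.exp_inj]
    push_cast
    omega
  -- ultrametric constraints from `c₆² = c₄³ - 1728 Δ` on `M`
  have hrel : (1728 : v.adicCompletion K) * (M.Δ : v.adicCompletion K) =
      (M.c₄ : v.adicCompletion K) ^ 3 - (M.c₆ : v.adicCompletion K) ^ 2 := by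
    have := congrArg (fun r : v.adicCompletionIntegers K => (r : v.adicCompletion K)) M.c_relation
    push_cast at this
    exact this
  have hV4 : Valued.v ((M.c₄ : v.adicCompletion K) ^ 3) = WithZero.exp (-(3 * (a : ℤ))) := by
    rw [map_pow, ha, withZero_exp_pow]; congr 1; ring
  have hV6 : Valued.v ((M.c₆ : v.adicCompletion K) ^ 2) = WithZero.exp (-(2 * (b : ℤ))) := by
    rw [map_pow, hb, withZero_exp_pow]; congr 1; ring
  have hVD : Valued.v ((1728 : v.adicCompletion K) * (M.Δ : v.adicCompletion K)) =
      WithZero.exp (-((6 * t₂ + 3 * t₃ + d : ℕ) : ℤ)) := by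
    rw [map_mul, h1728, hd, ← WithZero.exp_add]; congr 1; push_cast; ring
  have h1 : 3 * a ≤ 2 * b ∨ 6 * t₂ + 3 * t₃ + d ≤ 2 * b := by
    have key : Valued.v ((M.c₆ : v.adicCompletion K) ^ 2) ≤
        max (Valued.v ((M.c₄ : v.adicCompletion K) ^ 3))
          (Valued.v ((1728 : v.adicCompletion K) * (M.Δ : v.adicCompletion K))) := by
      rw [show (M.c₆ : v.adicCompletion K) ^ 2 =
        (M.c₄ : v.adicCompletion K) ^ 3 - 1728 * (M.Δ : v.adicCompletion K) by
          rw [hrel]; ring]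
      exact Valuation.map_sub _ _ _
    rw [hV4, hV6, hVD, le_max_iff, WithZero.exp_le_exp, WithZero.exp_le_exp] at key
    omega
  have h2 : 2 * b ≤ 3 * a ∨ 6 * t₂ + 3 * t₃ + d ≤ 3 * a := by
    have key : Valued.v ((M.c₄ : v.adicCompletion K) ^ 3) ≤
        max (Valued.v ((M.c₆ : v.adicCompletion K) ^ 2))
          (Valued.v ((1728 : v.adicCompletion K) * (M.Δ : v.adicCompletion K))) := by
      rw [show (M.c₄ : v.adicCompletion K) ^ 3 =
        (M.c₆ : v.adicCompletion K) ^ 2 + 1728 * (M.Δ : v.adicCompletion K) by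
          rw [hrel]; ring]
      exact Valuation.map_add _ _ _
    rw [hV4, hV6, hVD, le_max_iff, WithZero.exp_le_exp, WithZero.exp_le_exp] at key
    omega
  have h3 : 3 * a ≤ 6 * t₂ + 3 * t₃ + d ∨ 2 * b ≤ 6 * t₂ + 3 * t₃ + d := by
    have key : Valued.v ((1728 : v.adicCompletion K) * (M.Δ : v.adicCompletion K)) ≤
        max (Valued.v ((M.c₄ : v.adicCompletion K) ^ 3))
          (Valued.v ((M.c₆ : v.adicCompletion K) ^ 2)) := by
      rw [hrel]
      exact Valuation.map_sub _ _ _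
    rw [hV4, hV6, hVD, le_max_iff, WithZero.exp_le_exp, WithZero.exp_le_exp] at key
    omega
  -- reduction data
  have hfle : W.conductorExponent v ≤ d := hdord ▸ conductorExponent_le_ordMinimalDiscriminant v W
  have hmem_iff : ∀ r : v.adicCompletionIntegers K, r ≠ 0 → ∀ n : ℕ,
      Valued.v (r : v.adicCompletion K) = WithZero.exp (-(n : ℤ)) →
      (r ∈ IsLocalRing.maximalIdeal (v.adicCompletionIntegers K) ↔ 0 < n) := by
    intro r hr n hn
    rw [IsLocalRing.mem_maximalIdeal, mem_nonunits_iff,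
      IsDedekindDomain.HeightOneSpectrum.adicCompletionIntegers.isUnit_iff_valued_eq_one, hn,
      ← WithZero.exp_zero, WithZero.exp_inj]
    omega
  have h6v : Valued.v ((6 : v.adicCompletionIntegers K) : v.adicCompletion K) =
      WithZero.exp (-((t₂ + t₃ : ℕ) : ℤ)) := by
    rw [show ((6 : v.adicCompletionIntegers K) : v.adicCompletion K) = (6 : v.adicCompletion K)
      from map_ofNat (algebraMap (v.adicCompletionIntegers K) (v.adicCompletion K)) 6,
      show (6 : v.adicCompletion K) = 2 * 3 by norm_num, map_mul, h2v, h3v, ← WithZero.exp_add]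
    congr 1; push_cast; ring
  have hminimal : a < 4 * (t₂ + t₃) + 4 ∨ b < 6 * (t₂ + t₃) + 6 :=
    localMinimal_ord_c₄_c₆_lt v W a b (t₂ + t₃) ha.le hb.le h6v
  have hred : (d = 0 ∧ W.conductorExponent v = 0) ∨ (0 < d ∧ a = 0 ∧ 1 ≤ W.conductorExponent v) ∨
      (0 < d ∧ 0 < a ∧ 2 ≤ W.conductorExponent v ∧
        (a < 4 * (t₂ + t₃) + 4 ∨ b < 6 * (t₂ + t₃) + 6)) := by
    rcases hasGoodReductionAt_or_hasMultiplicativeReductionAt_or_hasAdditiveReductionAt v W with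
      hg | hm | hadd
    · left
      have hd0 : d = 0 := hdord ▸ (ordMinimalDiscriminant_eq_zero_iff_holds v W).mpr hg
      exact ⟨hd0, by omega⟩
    · right; left
      obtain ⟨hΔm, hc4m⟩ := (hasMultiplicativeReductionAt_iff_mem v W).mp hm
      have hd0 : 0 < d := (hmem_iff M.Δ hMΔ d hd).mp hΔm
      have ha0 : a = 0 := by
        have := (hmem_iff M.c₄ hMc4 a ha).not.mp hc4m
        omega
      refine ⟨hd0, ha0, Nat.one_le_iff_ne_zero.mpr ?_⟩
      exact (conductorExponent_ne_zero_iff_ordMinimalDiscriminant_ne_zero v W).mpr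
        (by rw [hdord]; omega)
    · right; right
      obtain ⟨hΔm, hc4m⟩ := (hasAdditiveReductionAt_iff_mem v W).mp hadd
      have hd0 : 0 < d := (hmem_iff M.Δ hMΔ d hd).mp hΔm
      have ha0 : 0 < a := (hmem_iff M.c₄ hMc4 a ha).mp hc4m
      exact ⟨hd0, ha0, (two_le_conductorExponent_iff_holds v W).mpr hadd, hminimal⟩
  -- the `δ`-indicator
  have hL : 0 ≤ Real.log (Ideal.absNorm v.asIdeal) :=
    Real.log_nonneg (by exact_mod_cast (NumberField.HeightOneSpectrum.one_lt_absNorm v).le)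
  set δ : ℤ := if v ∈ Literature.NumberTheory.DiophantineGeometry.badPrimes x (1 - x) 1 then 1 else 0
    with hδdef
  have hδ : δ = 0 ∨ (δ = 1 ∧ (3 * a ≠ 6 * t₂ + 3 * t₃ + d ∨ 2 * b ≠ 6 * t₂ + 3 * t₃ + d)) := by
    by_cases hb : v ∈ Literature.NumberTheory.DiophantineGeometry.badPrimes x (1 - x) 1
    · right
      refine ⟨by rw [hδdef, if_pos hb], ?_⟩
      have := hbad.mp hb
      omega
    · left; rw [hδdef, if_neg hb]
  have hind : (if v ∈ Literature.NumberTheory.DiophantineGeometry.badPrimes x (1 - x) 1 then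
      Real.log (Ideal.absNorm v.asIdeal) else 0) = (δ : ℝ) * Real.log (Ideal.absNorm v.asIdeal) := by
    rw [hδdef]; split_ifs <;> simp
  obtain ⟨core1, core2⟩ :=
    szpiro_local_core a b d (W.conductorExponent v) t₂ t₃ h1 h2 h3 hred δ hδ
  rw [log_max_one_finitePlace v hvx, log_max_one_finitePlace v hvxi, log_max_one_finitePlace v hv1xi,
    hdord, hind]
  have key1 := mul_le_mul_of_nonneg_right (Int.cast_le (R := ℝ).mpr core1) hL
  have key2 := mul_le_mul_of_nonneg_right (Int.cast_le (R := ℝ).mpr core2) hL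
  push_cast at key1 key2 ⊢
  constructor
  · linarith [key1]
  · linarith [key2]

end LocalIneq

end WeierstrassCurve
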